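import Summits.ABC.StewartYu.ArchG3Output
import Summits.ABC.StewartYu.GenThreeEndBridgeReal
import Summits.ABC.StewartYu.GenThreeFrameSpecOddRat
import Summits.ABC.StewartYu.SatCoords
import HarnessLib

/-!
# Cell abc-stewartyu, WP-L.A (crux r2 `ArchCoreRat`, stmt-ABC-20502): the ξ-OUTPUT of the saturated archimedean frame — the last-level
# identities in `θ^{v·x}` with `b̃`-directions ARE identities at the real root point `(x, ξˣ)`, `ξⱼ = aⱼ^{1/N}`, with `b`-directions

`Summits/ABC/StewartYu/ArchG3XiOutput.lean` — cell `abc-stewartyu` (HOME `run/shared/lean/pub/abc-stewartyu/`), route `YuMatveevShapeRat`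
(rung A1.L), seat p4 (g9; plan g12 RULING R32 (c2) «ξ-OUTPUT FILE», R35 (b)).  Theorems only; no definition, no named fact, no record.
The archimedean twin of p2's `PadicG3SatOutput.frameOutputSat` (no even points, no squaring), stated over GENERIC saturation data so that
p5's `ArchG3SatData` instance (R34 (1)) plugs in:

the frame `S : ArchG3Setup` runs on a saturated basis `θ = S.α` with coefficients `b̃ = S.b` and pivot `S.j₀`; the ORIGINAL datum is
`a` (positive rationals), `b`, with `θᵢ^N = ∏ⱼ aⱼ^{Uᵢⱼ}` and `b̃ ᵥ* U = N·b` (`U` integer, `ν := (· ᵥ* U)` injective); the last-level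
invariant `ArchLvInv (feldR ·.1 H) B v pv … {|x| ≤ N₀} T` (lp-1 `ArchG3ScheduleQ.lastLevelInv_feldR`) with the VIRTUAL box
`|ν(vᵢ)ⱼ| ≤ Bvⱼ` (the Q-hook at level `Ŝ`) gives `GenThreeFrameSpecTwoRat.FrameOutputReal n ξ b j₀ D₀ S₀ X′ Bv` at
`ξ = rootUnitsN N a` for ANY index `j₀` — exactly the input of `GenThreeFrameSpecArchW.FrameArchW` / `GenThreeEndReal.exists_exits_units`.
Steps: the monomial identities `archφ … (t, ν′) x = 0` (`ArchLvInv.archφ_monomial_eq_zero`), `MomentGL`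
(`DirWeights.sum_mul_prod_pow_eq_zero_of_linear`) from the `b̃`-directions `zγ(v)ₖ` to the `b`-directions of the virtual exponents
(`bDir_eq_sum_mul_zγ_sat`: `b_{j₀}ν(v)ⱼ − bⱼν(v)_{j₀} = Σₖ (b_{j₀}Uₖⱼ − bⱼU_{kj₀})·zγ(v)ₖ` because `Σₖ(…)b̃ₖ = 0`), the dictionary
`θ^{v·x} = ∏ ξⱼ^{x·ν(v)ⱼ}` in `ℝ_{>0}` (`GenThreeFrameSpecOddRat.ratCast_eq_prod_rootUnitsN_zpow` + `SatCoords.prod_zpow_pow_eq`), and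
p2's bridge `GenThreeEndBridgeReal.frameOutputReal_of_hasseIdentities`.

WHAT THIS IS NOT: no record, no END call (that is `GenThreeFrameSpecArchW.dichotomyArchW_of_frame`); no crux moves.

References: Yu. V. Nesterenko, LNM 1819 (2003), §5.1 (5.3)–(5.4) (p. 96: `ξⱼ = αⱼ^{1/N}`); K. Yu, Acta Math. 211 (2013), §6.
-/

noncomputable section

open Finset Polynomial
open scoped Matrix
open Literature.NumberTheory.Transcendental
open Literature.NumberTheory.Transcendental.CW77.Setup (Tau tauNorm)
open Summit.ABC.StewartYu.FeldmanBasis (feldR exists_fibre_ne_zero natDegree_feldR_le)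
open Summit.ABC.StewartYu.GenThreeFrameSpecTwoRat (FrameOutputReal)
open Summit.ABC.StewartYu.GenThreeFrameSpecOddRat (rootUnitsN ratCast_eq_prod_rootUnitsN_zpow)
open scoped Nat

namespace Summit.ABC.StewartYu

namespace ArchG3Setup

variable (S : ArchG3Setup)

/-- **The direction change** (generic saturation data): if `S.b ᵥ* U = N·b` then, for `gⱼₖ := b_{j₀}·Uₖⱼ − bⱼ·U_{k j₀}`,
`b_{j₀}·ν(v)ⱼ − bⱼ·ν(v)_{j₀} = Σₖ gⱼₖ·zγ(v)ₖ` (`ν(v) = v ᵥ* U`; because `Σₖ gⱼₖ·b̃ₖ = 0`). [folklore] -/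
theorem bDir_eq_sum_mul_zγ_sat (U : Matrix (Fin S.n) (Fin S.n) ℤ) (Nsat : ℕ) (b : Fin S.n → ℤ)
    (hbU : S.b ᵥ* U = (Nsat : ℤ) • b) (j₀ : Fin S.n) (v : Fin S.n → ℤ) (j : Fin S.n) :
    ((b j₀ * (v ᵥ* U) j - b j * (v ᵥ* U) j₀ : ℤ) : ℚ) =
      ∑ k, ((b j₀ * U k j - b j * U k j₀ : ℤ) : ℚ) * S.zγ v k := by
  have hb0 : (S.b S.j₀ : ℚ) ≠ 0 := by exact_mod_cast S.bj₀_ne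
  -- `Σₖ gⱼₖ b̃ₖ = 0`
  have e1 : ∀ j', (∑ k, (S.b k : ℚ) * (U k j' : ℚ)) = (Nsat : ℚ) * (b j' : ℚ) := by
    intro j'
    have h := congrFun hbU j'
    simp only [Matrix.vecMul, dotProduct, Pi.smul_apply, smul_eq_mul] at h
    have h' := congrArg (fun z : ℤ => (z : ℚ)) h
    push_cast at h'
    exact h'
  have hsum0 : ∑ k, ((b j₀ * U k j - b j * U k j₀ : ℤ) : ℚ) * (S.b k : ℚ) = 0 := by
    calc ∑ k, ((b j₀ * U k j - b j * U k j₀ : ℤ) : ℚ) * (S.b k : ℚ)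
        = (b j₀ : ℚ) * ∑ k, (S.b k : ℚ) * (U k j : ℚ) - (b j : ℚ) * ∑ k, (S.b k : ℚ) * (U k j₀ : ℚ) := by
          rw [mul_sum, mul_sum, ← sum_sub_distrib]
          refine sum_congr rfl fun k _ => ?_
          push_cast; ring
      _ = 0 := by rw [e1 j, e1 j₀]; ring
  -- clear the denominator `b̃_{j₀}`
  have hz : ∀ k, S.zγ v k * (S.b S.j₀ : ℚ) = ((S.b S.j₀ * v k - S.b k * v S.j₀ : ℤ) : ℚ) := by
    intro k; unfold zγ 𝔛; rw [div_mul_cancel₀ _ hb0]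
  refine mul_right_cancel₀ hb0 ?_
  have hR : (∑ k, ((b j₀ * U k j - b j * U k j₀ : ℤ) : ℚ) * S.zγ v k) * (S.b S.j₀ : ℚ) =
      (S.b S.j₀ : ℚ) * ∑ k, ((b j₀ * U k j - b j * U k j₀ : ℤ) : ℚ) * (v k : ℚ) := by
    rw [sum_mul]
    have h1 : ∑ k, ((b j₀ * U k j - b j * U k j₀ : ℤ) : ℚ) * S.zγ v k * (S.b S.j₀ : ℚ) =
        ∑ k, ((b j₀ * U k j - b j * U k j₀ : ℤ) : ℚ) * (((S.b S.j₀ * v k - S.b k * v S.j₀ : ℤ)) : ℚ) :=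
      sum_congr rfl fun k _ => by rw [mul_assoc, hz k]
    have h2 : ∑ k, ((b j₀ * U k j - b j * U k j₀ : ℤ) : ℚ) * (((S.b S.j₀ * v k - S.b k * v S.j₀ : ℤ)) : ℚ) =
        (S.b S.j₀ : ℚ) * ∑ k, ((b j₀ * U k j - b j * U k j₀ : ℤ) : ℚ) * (v k : ℚ) -
          (v S.j₀ : ℚ) * ∑ k, ((b j₀ * U k j - b j * U k j₀ : ℤ) : ℚ) * (S.b k : ℚ) := by
      rw [mul_sum, mul_sum, ← sum_sub_distrib]
      refine sum_congr rfl fun k _ => ?_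
      push_cast; ring
    rw [h1, h2, hsum0, mul_zero, sub_zero]
  rw [hR]
  have h3 : ∀ j', ((v ᵥ* U) j' : ℚ) = ∑ k, (v k : ℚ) * (U k j' : ℚ) := by
    intro j'; simp only [Matrix.vecMul, dotProduct]; push_cast; rfl
  have h4 : ∑ k, ((b j₀ * U k j - b j * U k j₀ : ℤ) : ℚ) * (v k : ℚ) =
      (b j₀ : ℚ) * ∑ k, (v k : ℚ) * (U k j : ℚ) - (b j : ℚ) * ∑ k, (v k : ℚ) * (U k j₀ : ℚ) := by
    rw [mul_sum, mul_sum, ← sum_sub_distrib]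
    refine sum_congr rfl fun k _ => ?_
    push_cast; ring
  rw [h4]
  push_cast
  rw [h3 j, h3 j₀]
  ring

namespace ArchLvInv

variable {S} {K : Type*} [DecidableEq K] {B : Finset (ℕ × K)} {v : ℕ × K → Fin S.n → ℤ} {pv : ℕ × K → ℤ}
  {lo : Fin S.n → ℤ} {L : Fin S.n → ℕ} {P : ℤ} {w γ : ℝ} {c : ℤ} {e : Fin S.n → ℤ} {N₀ T H : ℕ}

/-- **THE ξ-OUTPUT OF THE SATURATED ARCHIMEDEAN FRAME** (R32 (c2)).  The frame `S` runs on a saturated basis `θ = S.α` (positive,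
`θᵢ^N = ∏ aⱼ^{Uᵢⱼ}`) with coefficients `b̃ = S.b`, `b̃ ᵥ* U = N·b`, `ν = (· ᵥ* U)` injective; its last-level invariant at the nodes
`|x| ≤ N₀` of order `T` (Fel'dman weights `Δ(Y₀; ℓ₀, H)`, `ℓ₀ ≤ D₀` on `B`, exponents injective in `λ`) with the VIRTUAL last-level box
`|ν(vᵢ)ⱼ| ≤ Bvⱼ`, `(n+1)X′ ≤ N₀`, `(n+1)S₀ < T` gives `FrameOutputReal n ξ b j₀ D₀ S₀ X′ Bv` at `ξ = rootUnitsN N a` for ANY `j₀`.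
[cite: Nesterenko2003, §5.1 (5.3)–(5.4) (p. 96)] [cite: Yu2013, §6] -/
theorem frameOutputReal_sat (h : S.ArchLvInv (fun i => feldR i.1 H) B v pv lo L P w γ c e {x : ℤ | |x| ≤ (N₀ : ℤ)} T)
    (a : Fin S.n → ℚ) (ha : ∀ j, 0 < a j) (U : Matrix (Fin S.n) (Fin S.n) ℤ) {Nsat : ℕ} (hNsat : 1 ≤ Nsat)
    (hU : ∀ i, S.α i ^ Nsat = ∏ j, a j ^ U i j) (b : Fin S.n → ℤ) (hbU : S.b ᵥ* U = (Nsat : ℤ) • b)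
    (hνinj : ∀ w w' : Fin S.n → ℤ, w ᵥ* U = w' ᵥ* U → w = w')
    {D₀ : ℕ} (hdeg : ∀ i ∈ B, i.1 ≤ D₀) (hv : ∀ i ∈ B, ∀ i' ∈ B, v i = v i' ↔ i.2 = i'.2)
    {Bv : Fin S.n → ℕ} (hbox : ∀ i ∈ B, ∀ j, |(v i ᵥ* U) j| ≤ (Bv j : ℤ))
    {X' S₀ : ℕ} (hX : (S.n + 1) * X' ≤ N₀) (hS : (S.n + 1) * S₀ < T) (j₀ : Fin S.n) :
    FrameOutputReal S.n (rootUnitsN Nsat a ha) b j₀ D₀ S₀ X' Bv := by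
  classical
  obtain ⟨i₀, hi₀B, hi₀⟩ := h.nonzero
  have ha0 : ∀ j, a j ≠ 0 := fun j => (ha j).ne'
  have hNpos : 0 < Nsat := hNsat
  refine GenThreeEndBridgeReal.frameOutputReal_of_hasseIdentities B (fun i => feldR i.1 H) (fun i => v i ᵥ* U)
    (fun i => (pv i : ℚ)) _ b j₀ D₀ S₀ X' Bv ?_ hbox ?_ ?_
  · -- degrees
    intro i hi
    exact (natDegree_feldR_le _ _).trans (hdeg i hi)
  · -- a non-zero exponent fibre (degree-triangular basis, injectivity of `ν` and of `λ ↦ v`)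
    obtain ⟨κ₀, hne⟩ := exists_fibre_ne_zero H B pv hi₀B hi₀
    have hnonempty : (B.filter (fun i => i.2 = κ₀)).Nonempty := by
      by_contra h0
      rw [Finset.not_nonempty_iff_eq_empty] at h0
      rw [h0, sum_empty] at hne
      exact hne rfl
    obtain ⟨i₁, hi₁⟩ := hnonempty
    have hi₁B : i₁ ∈ B := (mem_filter.mp hi₁).1
    have hi₁κ : i₁.2 = κ₀ := (mem_filter.mp hi₁).2
    refine ⟨v i₁ ᵥ* U, ?_⟩
    have hfib : B.filter (fun i => v i ᵥ* U = v i₁ ᵥ* U) = B.filter (fun i => i.2 = κ₀) := by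
      refine filter_congr fun i hi => ?_
      rw [← hi₁κ, ← hv i hi i₁ hi₁B]
      exact ⟨fun h2 => hνinj _ _ h2, fun h2 => by rw [h2]⟩
    rw [hfib]
    exact hne
  · -- the identities at the root point
    intro x hx t ν _hν hsum
    have hxN : |x| ≤ (N₀ : ℤ) := le_trans hx (by exact_mod_cast hX)
    -- (a) the moments in the `b̃`-basis vanish, for all orders `|ν'| ≤ T − 1 − t`
    set W : ℕ × K → ℚ := fun i => (pv i : ℚ) * (hasseDeriv t (feldR i.1 H)).eval ((x : ℤ) : ℚ) *
      ∏ j, S.α j ^ (v i j * x) with hW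
    have hmomX : ∀ ν' : Fin S.n → ℕ, ∑ k, ν' k ≤ T - 1 - t → ∑ i ∈ B, W i * ∏ k, S.zγ (v i) k ^ ν' k = 0 := by
      intro ν' hν'
      have hτ : tauNorm ((t, ν') : Tau S.n) < T := by
        unfold tauNorm; simp only; omega
      have hvan := h.archφ_monomial_eq_zero (Xs := {x : ℤ | |x| ≤ (N₀ : ℤ)}) hxN (t, ν') hτ
      unfold archφ at hvan
      rw [← hvan]
      refine sum_congr rfl fun i _ => ?_
      simp only [hW, zγpow]
      ring
    -- (b) `MomentGL`: the moments in the `b`-basis of the virtual exponents vanish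
    have hmomY := DirWeights.sum_mul_prod_pow_eq_zero_of_linear B W (fun i k => S.zγ (v i) k)
      (fun i j => ((b j₀ * (v i ᵥ* U) j - b j * (v i ᵥ* U) j₀ : ℤ) : ℚ))
      (fun j k => ((b j₀ * U k j - b j * U k j₀ : ℤ) : ℚ))
      (fun i _ j => S.bDir_eq_sum_mul_zγ_sat U Nsat b hbU j₀ (v i) j) (T - 1 - t) hmomX ν (by omega)
    -- (c) cast to `ℂ`: the monomial `θ^{v·x}` is `∏ ξⱼ^{x·ν(v)ⱼ}`
    have hmono : ∀ i ∈ B, (((∏ j, S.α j ^ (v i j * x) : ℚ)) : ℂ) =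
        ∏ j, ((rootUnitsN Nsat a ha j : ℂˣ) : ℂ) ^ (x * (v i ᵥ* U) j) := by
      intro i _
      have hpow := SatCoords.prod_zpow_pow_eq a S.α U Nsat ha0 hU (fun j => v i j * x)
      have hexp : ∀ j, ((fun j => v i j * x) ᵥ* U) j = x * (v i ᵥ* U) j := by
        intro j
        have : (fun j => v i j * x) = x • v i := by funext j'; simp [mul_comm]
        rw [this, Matrix.smul_vecMul]
        simp only [Pi.smul_apply, smul_eq_mul]
      refine ratCast_eq_prod_rootUnitsN_zpow Nsat hNpos a ha _ (SatCoords.prod_zpow_pos S.α S.α_pos _) _ ?_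
      rw [hpow]
      exact prod_congr rfl fun j _ => by rw [hexp j]
    have hterm : ∀ i ∈ B, ((pv i : ℚ) : ℂ) * (((hasseDeriv t (feldR i.1 H)).eval (x : ℚ) : ℚ) : ℂ) *
        (∏ k, (((b j₀ * (v i ᵥ* U) k - b k * (v i ᵥ* U) j₀ : ℤ)) : ℂ) ^ ν k) *
        ∏ j, ((rootUnitsN Nsat a ha j : ℂˣ) : ℂ) ^ (x * (v i ᵥ* U) j) =
        (((W i * ∏ j, ((b j₀ * (v i ᵥ* U) j - b j * (v i ᵥ* U) j₀ : ℤ) : ℚ) ^ ν j : ℚ)) : ℂ) := by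
      intro i hi
      rw [← hmono i hi]
      simp only [hW]
      push_cast
      ring
    rw [sum_congr rfl hterm, ← Rat.cast_sum, hmomY, Rat.cast_zero]

end ArchLvInv

end ArchG3Setup

end Summit.ABC.StewartYu

end
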